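import Summits.BirchSwinnertonDyer.Rank1Residual.Additive.LocalTorsionAnomalousResidue
import Summits.BirchSwinnertonDyer.Rank1Residual.Additive.GordTorsionFiveSeven
import Summits.BirchSwinnertonDyer.Rank1Residual.Additive.GordAnomalousResidueThreeSix
import HarnessLib

/-!
# THE TORSION EXCEPTION IS ANOMALOUS: on the (G)-cell a rational `p`-torsion point forces
# anomalous reduction over the (G)-field, so `ReductionNonAnomalous W p ⟹ E(ℚ_p)[p] = 0 ∧ t = 0`
# at every `p ≥ 5` with NO Kodaira proviso

HONEST FRAMING (cell `b2b-bsdres`, run/shared/lean/b2b/bsd-rank1-residual/, verbatim in every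
file): the goal of the cell is to DELETE the COMBINATION-SHAPED residual classes of the
Birch–Swinnerton-Dyer formula for ALL analytic-rank `≤ 1` elliptic curves over `ℚ` — "full BSD
formula for every rank `≤ 1` curve in class `C`" assembled STRICTLY from published theorems — so
that the rank-`≤ 1` remainder becomes exactly the CONSTRUCTION-SHAPED classes, which are TYPED
(missing-input `Prop`s), NOT attempted. This is not "finishing BSD". Sub-cell `additive-p2`
(X3♯(G-ord) / X4♯(G-ord)), generation 38: research route; no claim beyond the stated classes;
theorems only, no definition, no named fact, nothing booked, no label moved.

## What and why

Delbourgo's Theorem (B) (J. Number Theory 95 (2002); the tree's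
`Delbourgo2002.LeadingTermClauses`) carries two per-pair provisos in its clause 3: the factor `ℓ`
(`= 1` if `ReductionNonAnomalous W p`) and the torsion term `#E(ℚ)_tors²`, i.e. `2t`,
`t = ord_p #E(ℚ)_tors`.  Generation 36 DECIDED `ReductionNonAnomalous W p` on the (G)-cell by one
residue of Cremona's `(c₄, c₆)` (`Additive/GordAnomalousResidueFour/ThreeSix`); generation 37
proved `t = 0` at every additive `p ≥ 5` EXCEPT on `v₅(c₄) = 1` (II/III@5) / `v₇(c₆) = 1` (II@7)
— on the (G)-cell: except on III@5 (`e = 4`) and II@7 (`e = 6`) — where rational `p`-torsion does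
occur (`X₁(5)`, `X₁(7)`; inside X3♯(G-ord): class 490k).  This file shows that the exception is
contained in the anomalous locus:

* **`sq_dvd_c₄_add_or_c₆_sub_of_prime_zsmul_eq_zero_of_addv`** (`W/ℚ` globally minimal,
  `Addv W p`, `p ≥ 5`): a `ℚ_p`-point `P ≠ O` with `p • P = O` forces
  `(p = 5 ∧ 25 ∣ c₄(E_ℤ) + 5) ∨ (p = 7 ∧ 49 ∣ c₆(E_ℤ) − 7)` — the residue, not only the valuation
  (`Additive/LocalTorsionAnomalousResidue`: second-order cusp jets of `ψ₅`, `ψ₇` and the square class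
  of `x(P)`); equivalently `c₄ = n·(−5)`, `n ≡ 1 (mod 5)` resp. `c₆ = n·(−7)`, `n ≡ −1 (mod 7)`;
  census forms `eq_zero_of_prime_nsmul_eq_zero_of_addv_of_not_sq_dvd`,
  `padicValNat_torsionOrder_eq_zero_of_addv_of_not_sq_dvd` (`t = 0` unless `25 ∣ c₄ + 5` / `49 ∣ c₆ − 7`);
* **`TypeG.not_reductionNonAnomalous_of_prime_zsmul_eq_zero`**: on the (G)-cell (`p ≥ 5`) a
  `ℚ_p`-point `P ≠ O` with `p • P = O` makes the reduction over the (G)-field ANOMALOUS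
  (`¬ ReductionNonAnomalous W p`) — by generation 37 the pair is III@5 or II@7, and there the forced
  residue IS generation 36's anomalous residue (`c₄/(−5) ≡ 1 (mod 5)`, LAW 6: `#Ẽ(𝔽₅) = 10`;
  `c₆/(−7) ≡ −1 (mod 7)`, LAW 7: `7 ∣ #Ẽ(𝔽₇)`);
* hence **`TypeG.eq_zero_of_prime_nsmul_eq_zero_of_reductionNonAnomalous`** (`E(ℚ_p)[p] = 0`),
  **`TypeG.padicValNat_torsionOrder_eq_zero_of_reductionNonAnomalous`** (`t = 0`), and the class
  forms **`ClassX3Gord/ClassX4Gord.padicValNat_torsionOrder_eq_zero_of_reductionNonAnomalous`**: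
  under the proviso `ReductionNonAnomalous W p` of clause 3 — the proviso of every exact (`ℓ = 1`)
  statement of the sub-cell since generation 18 — the torsion term vanishes too, on the WHOLE
  (G)-cell at every `p ≥ 5`, with no Kodaira / valuation side condition left.

(The converse fails: anomalous (G)-pairs without rational `p`-torsion abound — 70 anomalous
defect-`4` rows at `5` vs 11 classes with a `5`-torsion member in the window; EVIDENCE
`gen38/TORSION-ANOMALOUS-READING.md`.)

References: [Mazur1977] B. Mazur, Publ. Math. IHÉS 47 (1977), Ch. III §5, Step 1, p. 158 (method);
[Delbourgo2002] D. Delbourgo, J. Number Theory 95 (2002), p. 39 (`ℓ_p(E)`), Thm (B);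
[Delbourgo1998] D. Delbourgo, Compositio Math. 113 (1998) §1.5 (types (G), (M));
[SilvermanATAEC1994] IV Table 4.1.
-/

noncomputable section

open scoped Classical NumberField

namespace Summit.BirchSwinnertonDyer.Rank1Residual.Additive

open WeierstrassCurve IsDedekindDomain NumberField Literature.NumberTheory.EllipticCurves
  Literature.NumberTheory.EllipticCurves.Rank1Residual

variable (W : WeierstrassCurve ℚ) [W.IsElliptic] [W.IsGloballyMinimal] (p : ℕ) [hp : Fact p.Prime]

/-! ## §1 `E/ℚ` at an additive `p ≥ 5`: the residue of `c₄/5`, `c₆/7` forced by `p`-torsion -/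

omit [W.IsElliptic] in
/-- `c₄(E) = c₄(E_ℤ)` for the integer model of a globally minimal `W`. [folklore] -/
theorem c₄_eq_intCast_integralModelInt : W.c₄ = ((integralModelInt W).c₄ : ℚ) := by
  have h := (integralModelInt W).map_c₄ (Int.castRingHom ℚ)
  rw [map_integralModelInt, eq_intCast] at h
  exact h

omit [W.IsElliptic] in
/-- `c₆(E) = c₆(E_ℤ)` for the integer model of a globally minimal `W`. [folklore] -/
theorem c₆_eq_intCast_integralModelInt : W.c₆ = ((integralModelInt W).c₆ : ℚ) := by
  have h := (integralModelInt W).map_c₆ (Int.castRingHom ℚ)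
  rw [map_integralModelInt, eq_intCast] at h
  exact h

/-- **`E/ℚ`, `W` globally minimal, `p ≥ 5` additive: a `ℚ_p`-point `P ≠ O` with `p • P = O` forces
`(p = 5 ∧ 25 ∣ c₄(E_ℤ) + 5) ∨ (p = 7 ∧ 49 ∣ c₆(E_ℤ) − 7)`** — `c₄ ≡ −5 (mod 25)` (so `v₅(c₄) = 1`
and `c₄/(−5) ≡ 1 (mod 5)`), resp. `c₆ ≡ 7 (mod 49)` (`v₇(c₆) = 1`, `c₆/(−7) ≡ −1 (mod 7)`).
Realised: `c₄ = −80` (`X₁(5)`), `c₆ = −7·681183` (`X₁(7)`, `d = 5`).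
[cite: Mazur1977, Ch. III §5, Step 1, p. 158] -/
theorem sq_dvd_c₄_add_or_c₆_sub_of_prime_zsmul_eq_zero_of_addv (hp5 : 5 ≤ p) (hadd : Addv W p)
    {P : (W.baseChange ℚ_[p]).toAffine.Point} (hP0 : P ≠ 0) (hP : (p : ℤ) • P = 0) :
    (p = 5 ∧ (25 : ℤ) ∣ (integralModelInt W).c₄ + 5) ∨
      (p = 7 ∧ (49 : ℤ) ∣ (integralModelInt W).c₆ - 7) := by
  haveI := X11b.Three.JetchevKummer.hasAdditiveReduction_baseChange_padic_of_not_good_of_not_mult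
    W p hadd.1 hadd.2
  haveI : (W.baseChange ℚ_[p]).IsElliptic := by rw [baseChange]; infer_instance
  rcases CuspTorsion.norm_c₄_add_or_norm_c₆_sub_of_prime_zsmul_eq_zero hp5 (W.baseChange ℚ_[p])
    hP0 hP with ⟨h5, hn⟩ | ⟨h7, hn⟩
  · subst h5
    refine Or.inl ⟨rfl, ?_⟩
    rw [baseChange_padic_c₄, c₄_eq_intCast_integralModelInt,
      show ((((integralModelInt W).c₄ : ℚ)) : ℚ_[5]) + ((5 : ℕ) : ℚ_[5]) =
        (((integralModelInt W).c₄ + 5 : ℤ) : ℚ_[5]) by push_cast; ring] at hn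
    obtain ⟨m, hm⟩ := (Padic.norm_int_le_pow_iff_dvd ((integralModelInt W).c₄ + 5) 2).mp
      (by exact_mod_cast hn)
    exact ⟨m, by rw [hm]; push_cast; ring⟩
  · subst h7
    refine Or.inr ⟨rfl, ?_⟩
    rw [baseChange_padic_c₆, c₆_eq_intCast_integralModelInt,
      show ((((integralModelInt W).c₆ : ℚ)) : ℚ_[7]) - ((7 : ℕ) : ℚ_[7]) =
        (((integralModelInt W).c₆ - 7 : ℤ) : ℚ_[7]) by push_cast; ring] at hn
    obtain ⟨m, hm⟩ := (Padic.norm_int_le_pow_iff_dvd ((integralModelInt W).c₆ - 7) 2).mp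
      (by exact_mod_cast hn)
    exact ⟨m, by rw [hm]; push_cast; ring⟩

/-- The same in gen 36's currency `c₄ = n·(−5)^v` / `c₆ = n·(−7)^v`: a `ℚ_p`-point `P ≠ O` with
`p • P = O` at an additive `p ≥ 5` forces **`(p = 5 ∧ c₄ = n·(−5), n ≡ 1 (mod 5))` or
`(p = 7 ∧ c₆ = n·(−7), n ≡ −1 (mod 7))`**. [cite: Mazur1977, Ch. III §5, Step 1, p. 158] -/
theorem exists_residue_of_prime_zsmul_eq_zero_of_addv (hp5 : 5 ≤ p) (hadd : Addv W p)
    {P : (W.baseChange ℚ_[p]).toAffine.Point} (hP0 : P ≠ 0) (hP : (p : ℤ) • P = 0) :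
    (p = 5 ∧ ∃ n : ℤ, ¬ (5 : ℤ) ∣ n ∧ n ≡ 1 [ZMOD 5] ∧ W.c₄ = n * (-(5 : ℚ)) ^ 1) ∨
      (p = 7 ∧ ∃ n : ℤ, ¬ (7 : ℤ) ∣ n ∧ n ≡ -1 [ZMOD 7] ∧ W.c₆ = n * (-(7 : ℚ)) ^ 1) := by
  rcases sq_dvd_c₄_add_or_c₆_sub_of_prime_zsmul_eq_zero_of_addv W p hp5 hadd hP0 hP with
    ⟨h5, m, hm⟩ | ⟨h7, m, hm⟩
  · refine Or.inl ⟨h5, 1 - 5 * m, ?_, ?_, ?_⟩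
    · omega
    · exact Int.modEq_iff_dvd.mpr ⟨m, by ring⟩
    · rw [c₄_eq_intCast_integralModelInt, show (integralModelInt W).c₄ = 25 * m - 5 by omega]
      push_cast; ring
  · refine Or.inr ⟨h7, -1 - 7 * m, ?_, ?_, ?_⟩
    · omega
    · exact Int.modEq_iff_dvd.mpr ⟨m, by ring⟩
    · rw [c₆_eq_intCast_integralModelInt, show (integralModelInt W).c₆ = 49 * m + 7 by omega]
      push_cast; ring

/-- **Census form on the whole additive locus: `E(ℚ_p)[p] = 0` at an additive `p ≥ 5` unless
`(p = 5 ∧ c₄(E_ℤ) ≡ −5 (mod 25))` or `(p = 7 ∧ c₆(E_ℤ) ≡ 7 (mod 49))`** — generation 37's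
`eq_zero_of_prime_nsmul_eq_zero_of_addv` with the valuation condition refined to the residue.
[cite: Mazur1977, Ch. III §5, Step 1, p. 158] -/
theorem eq_zero_of_prime_nsmul_eq_zero_of_addv_of_not_sq_dvd (hp5 : 5 ≤ p) (hadd : Addv W p)
    (h5 : p = 5 → ¬ (25 : ℤ) ∣ (integralModelInt W).c₄ + 5)
    (h7 : p = 7 → ¬ (49 : ℤ) ∣ (integralModelInt W).c₆ - 7)
    {P : (W.baseChange ℚ_[p]).toAffine.Point} (hP : p • P = 0) : P = 0 := by
  by_contra hP0
  rcases sq_dvd_c₄_add_or_c₆_sub_of_prime_zsmul_eq_zero_of_addv W p hp5 hadd hP0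
    (by rw [natCast_zsmul]; exact hP) with ⟨h, hd⟩ | ⟨h, hd⟩
  · exact h5 h hd
  · exact h7 h hd

/-- **Census form: `t = ord_p #E(ℚ)_tors = 0` at an additive `p ≥ 5` unless `c₄(E_ℤ) ≡ −5 (mod 25)`
(`p = 5`) / `c₆(E_ℤ) ≡ 7 (mod 49)` (`p = 7`)** — two residues of Cremona's integers decide the
torsion term of every leading-term identity at an additive prime. [cite: Mazur1977, Ch. III §5, Step 1, p. 158] -/
theorem padicValNat_torsionOrder_eq_zero_of_addv_of_not_sq_dvd (hp5 : 5 ≤ p) (hadd : Addv W p)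
    (h5 : p = 5 → ¬ (25 : ℤ) ∣ (integralModelInt W).c₄ + 5)
    (h7 : p = 7 → ¬ (49 : ℤ) ∣ (integralModelInt W).c₆ - 7) :
    padicValNat p W.torsionOrder = 0 :=
  padicValNat.eq_zero_of_not_dvd (not_dvd_torsionOrder_of_noPTorsion W p
    (fun _ hQ => eq_zero_of_prime_nsmul_eq_zero_of_addv_of_not_sq_dvd W p hp5 hadd h5 h7 hQ))

/-! ## §2 The (G)-cell: `p`-torsion ⟹ anomalous -/

variable {W p}

/-- **(G) and a `ℚ_p`-point `P ≠ O` with `p • P = O` (`p ≥ 5`) ⟹ the reduction over the (G)-field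
is ANOMALOUS: `¬ ReductionNonAnomalous W p`.** By generation 37 the pair is III@5 (`e = 4`) or II@7
(`e = 6`); the forced residue `c₄/(−5) ≡ 1 (mod 5)` resp. `c₆/(−7) ≡ −1 (mod 7)` is exactly
generation 36's anomalous residue (`reductionNonAnomalous_five_iff_of_semistabilityIndex_eq_four`,
`reductionNonAnomalous_seven_iff_of_three_dvd_semistabilityIndex`).
[cite: Delbourgo2002, p. 39 (definition of ℓ_p(E)); Mazur1977, Ch. III §5, Step 1, p. 158] -/
theorem TypeG.not_reductionNonAnomalous_of_prime_zsmul_eq_zero (hG : TypeG W p) (hp5 : 5 ≤ p)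
    (hadd : Addv W p) {P : (W.baseChange ℚ_[p]).toAffine.Point} (hP0 : P ≠ 0)
    (hP : (p : ℤ) • P = 0) : ¬ Delbourgo2002.ReductionNonAnomalous W p := by
  rcases hG.semistabilityIndex_of_prime_zsmul_eq_zero hp5 hadd hP0 hP with ⟨h5, he⟩ | ⟨h7, he⟩
  · rcases exists_residue_of_prime_zsmul_eq_zero_of_addv W p hp5 hadd hP0 hP with
      ⟨-, n, hpn, hn1, hc⟩ | ⟨h7, -⟩
    · subst h5
      rw [reductionNonAnomalous_five_iff_of_semistabilityIndex_eq_four W hG he hpn hc]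
      exact fun h => h hn1
    · omega
  · rcases exists_residue_of_prime_zsmul_eq_zero_of_addv W p hp5 hadd hP0 hP with
      ⟨h5, -⟩ | ⟨-, n, hpn, hn1, hc⟩
    · omega
    · subst h7
      have h3e : 3 ∣ semistabilityIndex W 7 := ⟨2, by rw [he]⟩
      rw [reductionNonAnomalous_seven_iff_of_three_dvd_semistabilityIndex W hG h3e hpn hc]
      exact fun h => h hn1

/-- The same with the cell's defect datum displayed: (G) and `p`-torsion in `E(ℚ_p)` ⟹
**`(p = 5 ∧ e = 4 ∧ c₄ = n·(−5), n ≡ 1 (mod 5)) ∨ (p = 7 ∧ e = 6 ∧ c₆ = n·(−7), n ≡ −1 (mod 7))`**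
— III@5 with `#Ẽ(𝔽₅) = 10` over `ℚ(ζ₅)`, or II@7 with `7 ∣ #Ẽ(𝔽₇)` over `ℚ(ζ₇)`.
[cite: Delbourgo2002, p. 39 (definition of ℓ_p(E)); Mazur1977, Ch. III §5, Step 1, p. 158] -/
theorem TypeG.residue_of_prime_zsmul_eq_zero (hG : TypeG W p) (hp5 : 5 ≤ p) (hadd : Addv W p)
    {P : (W.baseChange ℚ_[p]).toAffine.Point} (hP0 : P ≠ 0) (hP : (p : ℤ) • P = 0) :
    (p = 5 ∧ semistabilityIndex W p = 4 ∧
        ∃ n : ℤ, ¬ (5 : ℤ) ∣ n ∧ n ≡ 1 [ZMOD 5] ∧ W.c₄ = n * (-(5 : ℚ)) ^ 1) ∨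
      (p = 7 ∧ semistabilityIndex W p = 6 ∧
        ∃ n : ℤ, ¬ (7 : ℤ) ∣ n ∧ n ≡ -1 [ZMOD 7] ∧ W.c₆ = n * (-(7 : ℚ)) ^ 1) := by
  rcases hG.semistabilityIndex_of_prime_zsmul_eq_zero hp5 hadd hP0 hP with ⟨h5, he⟩ | ⟨h7, he⟩
  · rcases exists_residue_of_prime_zsmul_eq_zero_of_addv W p hp5 hadd hP0 hP with
      ⟨-, hn⟩ | ⟨h7, -⟩
    · exact Or.inl ⟨h5, he, hn⟩
    · omega
  · rcases exists_residue_of_prime_zsmul_eq_zero_of_addv W p hp5 hadd hP0 hP with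
      ⟨h5, -⟩ | ⟨-, hn⟩
    · omega
    · exact Or.inr ⟨h7, he, hn⟩

/-! ## §3 `ReductionNonAnomalous ⟹ E(ℚ_p)[p] = 0 ∧ t = 0` on the (G)-cell, no Kodaira proviso -/

/-- **On the (G)-cell, `ReductionNonAnomalous W p ⟹ E(ℚ_p)[p] = 0`** (`p ≥ 5`; no Kodaira / valuation
side condition). [cite: Delbourgo2002, p. 39 (definition of ℓ_p(E)); Mazur1977, Ch. III §5, Step 1, p. 158] -/
theorem TypeG.eq_zero_of_prime_nsmul_eq_zero_of_reductionNonAnomalous (hG : TypeG W p)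
    (hp5 : 5 ≤ p) (hadd : Addv W p) (hR : Delbourgo2002.ReductionNonAnomalous W p)
    {P : (W.baseChange ℚ_[p]).toAffine.Point} (hP : p • P = 0) : P = 0 := by
  by_contra hP0
  exact hG.not_reductionNonAnomalous_of_prime_zsmul_eq_zero hp5 hadd hP0
    (by rw [natCast_zsmul]; exact hP) hR

/-- **On the (G)-cell, `ReductionNonAnomalous W p ⟹ E(ℚ)[p] = 0`** (`E(ℚ) ↪ E(ℚ_p)`).
[cite: Delbourgo2002, p. 39 (definition of ℓ_p(E)); Mazur1977, Ch. III §5, Step 1, p. 158] -/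
theorem TypeG.eq_zero_of_prime_zsmul_eq_zero_rat_of_reductionNonAnomalous (hG : TypeG W p)
    (hp5 : 5 ≤ p) (hadd : Addv W p) (hR : Delbourgo2002.ReductionNonAnomalous W p)
    {P : W.toAffine.Point} (hP : (p : ℤ) • P = 0) : P = 0 := by
  have hinj : Function.Injective (W.toPadicPoint p) :=
    Affine.Point.map_injective (W' := W) (Algebra.ofId ℚ ℚ_[p])
  apply hinj
  rw [map_zero]
  exact hG.eq_zero_of_prime_nsmul_eq_zero_of_reductionNonAnomalous hp5 hadd hR
    (by rw [← natCast_zsmul, ← map_zsmul, hP, map_zero])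

/-- **On the (G)-cell, `ReductionNonAnomalous W p ⟹ p ∤ #E(ℚ)_tors`.**
[cite: Delbourgo2002, p. 39 (definition of ℓ_p(E)); Mazur1977, Ch. III §5, Step 1, p. 158] -/
theorem TypeG.not_dvd_torsionOrder_of_reductionNonAnomalous (hG : TypeG W p) (hp5 : 5 ≤ p)
    (hadd : Addv W p) (hR : Delbourgo2002.ReductionNonAnomalous W p) : ¬ p ∣ W.torsionOrder :=
  not_dvd_torsionOrder_of_noPTorsion W p
    (fun _ hQ => hG.eq_zero_of_prime_nsmul_eq_zero_of_reductionNonAnomalous hp5 hadd hR hQ)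

/-- **On the (G)-cell, `ReductionNonAnomalous W p ⟹ t = ord_p #E(ℚ)_tors = 0`** (`p ≥ 5`): under the
proviso of Delbourgo (B) clause 3 that makes `ℓ = 1`, the torsion term of the clause vanishes too —
the two provisos of every exact leading-term statement of the sub-cell collapse to ONE.
[cite: Delbourgo2002, p. 39 (definition of ℓ_p(E)); Mazur1977, Ch. III §5, Step 1, p. 158] -/
theorem TypeG.padicValNat_torsionOrder_eq_zero_of_reductionNonAnomalous (hG : TypeG W p)
    (hp5 : 5 ≤ p) (hadd : Addv W p) (hR : Delbourgo2002.ReductionNonAnomalous W p) :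
    padicValNat p W.torsionOrder = 0 :=
  padicValNat.eq_zero_of_not_dvd (hG.not_dvd_torsionOrder_of_reductionNonAnomalous hp5 hadd hR)

/-- (G)-ordinary form: **`TypeGOrd ∧ ReductionNonAnomalous ⟹ t = 0`** (`p ≥ 5`).
[cite: Delbourgo2002, p. 39 (definition of ℓ_p(E)); Delbourgo1998, §1.5] -/
theorem TypeGOrd.padicValNat_torsionOrder_eq_zero_of_reductionNonAnomalous (hG : TypeGOrd W p)
    (hp5 : 5 ≤ p) (hadd : Addv W p) (hR : Delbourgo2002.ReductionNonAnomalous W p) :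
    padicValNat p W.torsionOrder = 0 :=
  hG.typeG.padicValNat_torsionOrder_eq_zero_of_reductionNonAnomalous hp5 hadd hR

/-! ## §4 Class level: X3♯(G-ord), X4♯(G-ord) -/

/-- **X3♯(G-ord) off the anomalous rows: `t = ord_p #E(ℚ)_tors = 0`** (`p ≥ 5`), no Kodaira proviso
— in particular on the non-anomalous III@5 / II@7 rows that generation 37 had to except.
[cite: Delbourgo2002, p. 39 (definition of ℓ_p(E)); Delbourgo1998, §1.5] -/
theorem ClassX3Gord.padicValNat_torsionOrder_eq_zero_of_reductionNonAnomalous (hX : ClassX3Gord W p)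
    (hp5 : 5 ≤ p) (hR : Delbourgo2002.ReductionNonAnomalous W p) :
    padicValNat p W.torsionOrder = 0 :=
  hX.2.typeG.padicValNat_torsionOrder_eq_zero_of_reductionNonAnomalous hp5 hX.1.2 hR

/-- **X3♯(G-ord) off the anomalous rows: `E(ℚ_p)[p] = 0`** (`p ≥ 5`).
[cite: Delbourgo2002, p. 39 (definition of ℓ_p(E)); Delbourgo1998, §1.5] -/
theorem ClassX3Gord.eq_zero_of_prime_nsmul_eq_zero_of_reductionNonAnomalous (hX : ClassX3Gord W p)
    (hp5 : 5 ≤ p) (hR : Delbourgo2002.ReductionNonAnomalous W p)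
    {P : (W.baseChange ℚ_[p]).toAffine.Point} (hP : p • P = 0) : P = 0 :=
  hX.2.typeG.eq_zero_of_prime_nsmul_eq_zero_of_reductionNonAnomalous hp5 hX.1.2 hR hP

/-- **X4♯(G-ord) off the anomalous rows: `t = 0`** (`p ≥ 5`; on X4 the rational statement also
follows from irreducibility — here it comes with the LOCAL `E(ℚ_p)[p] = 0`).
[cite: Delbourgo2002, p. 39 (definition of ℓ_p(E)); Delbourgo1998, §1.5] -/
theorem ClassX4Gord.padicValNat_torsionOrder_eq_zero_of_reductionNonAnomalous (hX : ClassX4Gord W p)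
    (hp5 : 5 ≤ p) (hR : Delbourgo2002.ReductionNonAnomalous W p) :
    padicValNat p W.torsionOrder = 0 :=
  hX.2.typeG.padicValNat_torsionOrder_eq_zero_of_reductionNonAnomalous hp5 hX.1.2.1 hR

/-- **X4♯(G-ord) off the anomalous rows: `E(ℚ_p)[p] = 0`** (`p ≥ 5`).
[cite: Delbourgo2002, p. 39 (definition of ℓ_p(E)); Delbourgo1998, §1.5] -/
theorem ClassX4Gord.eq_zero_of_prime_nsmul_eq_zero_of_reductionNonAnomalous (hX : ClassX4Gord W p)
    (hp5 : 5 ≤ p) (hR : Delbourgo2002.ReductionNonAnomalous W p)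
    {P : (W.baseChange ℚ_[p]).toAffine.Point} (hP : p • P = 0) : P = 0 :=
  hX.2.typeG.eq_zero_of_prime_nsmul_eq_zero_of_reductionNonAnomalous hp5 hX.1.2.1 hR hP

/-- **The anomalous locus absorbs the torsion locus, class level**: on X3♯(G-ord) ∪ X4♯(G-ord)
(`p ≥ 5`) a `ℚ_p`-point `P ≠ O` with `p • P = O` ⟹ `¬ ReductionNonAnomalous W p` (the row carries the
flag `Del02-ThmB-ellp-anomalous`). [cite: Delbourgo2002, p. 39 (definition of ℓ_p(E)); Delbourgo1998, §1.5] -/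
theorem ClassX3Gord.not_reductionNonAnomalous_of_prime_zsmul_eq_zero (hX : ClassX3Gord W p)
    (hp5 : 5 ≤ p) {P : (W.baseChange ℚ_[p]).toAffine.Point} (hP0 : P ≠ 0)
    (hP : (p : ℤ) • P = 0) : ¬ Delbourgo2002.ReductionNonAnomalous W p :=
  hX.2.typeG.not_reductionNonAnomalous_of_prime_zsmul_eq_zero hp5 hX.1.2 hP0 hP

/-- X4♯(G-ord): `p`-torsion in `E(ℚ_p)` ⟹ `¬ ReductionNonAnomalous W p` (`p ≥ 5`).
[cite: Delbourgo2002, p. 39 (definition of ℓ_p(E)); Delbourgo1998, §1.5] -/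
theorem ClassX4Gord.not_reductionNonAnomalous_of_prime_zsmul_eq_zero (hX : ClassX4Gord W p)
    (hp5 : 5 ≤ p) {P : (W.baseChange ℚ_[p]).toAffine.Point} (hP0 : P ≠ 0)
    (hP : (p : ℤ) • P = 0) : ¬ Delbourgo2002.ReductionNonAnomalous W p :=
  hX.2.typeG.not_reductionNonAnomalous_of_prime_zsmul_eq_zero hp5 hX.1.2.1 hP0 hP

/-! ## §5 The special fibre over `ℚ(ζ_p)` seen by the torsion point -/

/-- **A rational `5`-torsion point on a (G)-pair makes the special fibre over `ℚ(ζ₅)` anomalous: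
`5 ∣ #Ẽ_𝔭(𝔽₅)`** (indeed `#Ẽ_𝔭(𝔽₅) = 10`, gen 35) for every `5`-th cyclotomic field `K` and every good
place `𝔭 ∋ 5` of `E_K`. [cite: Delbourgo2002, p. 39 (definition of ℓ_p(E)); IrelandRosen1990, Ch. 18 §4, Theorem 5] -/
theorem TypeG.five_dvd_natCard_point_reductionAt_of_prime_zsmul_eq_zero [h5 : Fact (Nat.Prime 5)]
    (hG : TypeG W 5) (hadd : Addv W 5) {P : (W.baseChange ℚ_[5]).toAffine.Point} (hP0 : P ≠ 0)
    (hP : ((5 : ℕ) : ℤ) • P = 0) {K : Type} [Field K] [NumberField K] [IsCyclotomicExtension {5} ℚ K]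
    {𝔭 : HeightOneSpectrum (𝓞 K)} (h𝔭 : ((5 : ℕ) : 𝓞 K) ∈ 𝔭.asIdeal)
    (hgood : (W.baseChange K).HasGoodReductionAt 𝔭) :
    5 ∣ Nat.card ((W.baseChange K).reductionAt 𝔭).toAffine.Point := by
  rcases hG.residue_of_prime_zsmul_eq_zero le_rfl hadd hP0 hP with
    ⟨-, he, n, hpn, hn1, hc⟩ | ⟨h7, -⟩
  · exact (five_dvd_natCard_point_reductionAt_iff_intCast_modEq_one W he h𝔭 hgood hpn hc).mpr hn1
  · exact absurd h7 (by norm_num)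

/-- **A rational `7`-torsion point on a (G)-pair makes the special fibre over `ℚ(ζ₇)` anomalous:
`7 ∣ #Ẽ_𝔭(𝔽₇)`** for every `7`-th cyclotomic field `K` and every good place `𝔭 ∋ 7` of `E_K`.
[cite: Delbourgo2002, p. 39 (definition of ℓ_p(E)); IrelandRosen1990, Ch. 18 §3, Theorem 4] -/
theorem TypeG.seven_dvd_natCard_point_reductionAt_of_prime_zsmul_eq_zero [h7 : Fact (Nat.Prime 7)]
    (hG : TypeG W 7) (hadd : Addv W 7) {P : (W.baseChange ℚ_[7]).toAffine.Point} (hP0 : P ≠ 0)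
    (hP : ((7 : ℕ) : ℤ) • P = 0) {K : Type} [Field K] [NumberField K] [IsCyclotomicExtension {7} ℚ K]
    {𝔭 : HeightOneSpectrum (𝓞 K)} (h𝔭 : ((7 : ℕ) : 𝓞 K) ∈ 𝔭.asIdeal)
    (hgood : (W.baseChange K).HasGoodReductionAt 𝔭) :
    7 ∣ Nat.card ((W.baseChange K).reductionAt 𝔭).toAffine.Point := by
  rcases hG.residue_of_prime_zsmul_eq_zero (by norm_num) hadd hP0 hP with
    ⟨h5, -⟩ | ⟨-, he, n, hpn, hn1, hc⟩
  · exact absurd h5 (by norm_num)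
  · have h3e : 3 ∣ semistabilityIndex W 7 := ⟨2, by rw [he]⟩
    exact (seven_dvd_natCard_point_reductionAt_iff_intCast_modEq_neg_one W h3e h𝔭 hgood hpn hc).mpr
      hn1

end Summit.BirchSwinnertonDyer.Rank1Residual.Additive

end
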